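import Mathlib
import Summits.Ventures.PercRepro2.Defs
import Summits.Ventures.PercRepro2.Graph
import Summits.Ventures.PercRepro2.OneColourSwitch
import Summits.Ventures.PercRepro2.RegionHubSign
import Summits.Ventures.PercRepro2.SideSwitch
import Summits.Ventures.PercRepro2.SideSwitchFibre
import Summits.Ventures.PercRepro2.SideSwitchClosed
import Summits.Ventures.PercRepro2.SideSwitchComps
import Summits.Ventures.PercRepro2.SideSwitchCompsFibre
import Summits.Ventures.PercRepro2.M9NoPocketDefs
import Summits.Ventures.PercRepro2.M9NoPocketWorld
import Summits.Ventures.PercRepro2.M9NoPocketWorldD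
import Summits.Ventures.PercRepro2.M9NoPocketFibre

/-!
# The clean partner `Ψ₂` of a doubly reached point — the worlds (blind cell PercRepro2,
p3 g39, 2026-08-29; `proofs/P3-POCKETRK.md` §5′ Step 1 and §9 K6, part 1)

At a doubly reached point `ω` (`Sep ∧ DOne`, `d ∈ K₂ ∩ M₂`; an `EX` point of its unit) let
`C` be a set of `Y`-side sided vertices of `G − d` closed inside the sided set (a union of
`Y`-side blocks) containing every `Y`-side vertex joined to `d` by an edge.  The CLEAN PARTNER
`Ψ₂ ω` flips every edge not touching `C`: the blocks outside `C` change side, the pocket and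
the outside are flipped, the edges from `d` into `C` stay `Y`.  In `G − d` the worlds of
`{r, s}` are `K₂(Ψ₂ ω) = M₂(ω) ∪ C` and `M₂(Ψ₂ ω) = K₂(ω) ∖ C` (`K2_endsD_psi2`,
`M2_endsD_psi2`: the side switch of the closed set `C` of `SideSwitchClosed`, followed by the
colour flip).  In `G`: the `W`-world of `{r, s}` at `Ψ₂ ω` lies in `K₂(G − d; ω) ∖ C`
(`M2_psi2_subset`), the `Y`-world in `M₂(G − d; ω) ∪ C ∪ {d} ∪ C_W(d; ω)`
(`K2_psi2_subset`), so **`Ψ₂ ω` is `Sep ∧ DOne`** (`sep2_psi2`, `DOne_psi2`).  Part 2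
(`M9PocketPsi2Sign`): `d ∈ K₂ ∖ M₂` at `Ψ₂ ω` (a `K`-only point) and the sign comparison.
Own work; std axioms.
-/

namespace Summit.Ventures.PercRepro2

namespace NoPocket

open Finset Classical OneColourSwitch SideSwitch

variable {V : Type*} {E : Type*} {ends : E → Sym2 V} {p q r s d : V} {ω : Config E}
  {C : Set V}

/-- `Ψ₂` is the colour flip of the side switch of `C`. -/
lemma psi2_eq_compl_flipTouch (ω : Config E) (C : Set V) :
    (fun e => if e ∈ touches ends C then ω e else !ω e) =
      OneColourSwitch.compl (flipTouch ends C ω) := by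
  funext e
  by_cases h : e ∈ touches ends C
  · simp [OneColourSwitch.compl, flipTouch_of_mem ends h, h]
  · simp [OneColourSwitch.compl, flipTouch_of_notMem ends h, h]

/-- `Ψ₂` on an edge touching `C`. -/
lemma psi2_of_mem {e : E} (h : e ∈ touches ends C) :
    (if e ∈ touches ends C then ω e else !ω e) = ω e := by
  simp [h]

/-- `Ψ₂` on an edge not touching `C`. -/
lemma psi2_of_notMem {e : E} (h : e ∉ touches ends C) :
    (if e ∈ touches ends C then ω e else !ω e) = !ω e := by
  simp [h]

section Worlds

variable (hdr : d ≠ r) (hds : d ≠ s)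
  (hT : ∀ e, ends e ≠ s(d, r) ∧ ends e ≠ s(d, s))
  (hsep : sep2 ends p q r s ω) (hD : DOne ends r s d ω)
  (hK : d ∈ K2 ends r s ω) (hM : d ∈ M2 ends r s ω)
  (hC : C ⊆ K2 (endsD ends d) r s ω) (hCr : r ∉ C) (hCs : s ∉ C)
  (hcl : ClosedIn (endsD ends d) (sided (endsD ends d) r s ω) C)
  (hCd : ∀ e y, ends e = s(d, y) → y ∈ K2 (endsD ends d) r s ω → y ∈ C)

include hdr hds hD hC hCr hCs in
/-- A vertex of `C` is not in the `W`-world of `G − d` (it would be doubly reached). -/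
lemma notMem_M2_endsD_of_mem_C {x : V} (hx : x ∈ C) : x ∉ M2 (endsD ends d) r s ω := by
  intro hxM
  have hxK : x ∈ K2 (endsD ends d) r s ω := hC hx
  have hxd : x ≠ d := by rintro rfl; exact not_mem_K2_endsD hdr hds ω hxK
  exact hD x (fun h => hCr (h ▸ hx)) (fun h => hCs (h ▸ hx)) hxd (K2_endsD_subset_K2 ω hxK)
    (M2_endsD_subset_M2 ω hxM)

include hdr hds hT hD hM in
/-- An edge from `d` into the `Y`-world of `G − d` is `Y` (a `W` edge would make its endpoint
doubly reached; the `T`-edges are excluded). -/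
lemma open_of_edge_d_K2_endsD {e : E} {y : V} (hey : ends e = s(d, y))
    (hy : y ∈ K2 (endsD ends d) r s ω) : ω e = true := by
  cases he : ω e
  · exfalso
    have hyd : y ≠ d := by rintro rfl; exact not_mem_K2_endsD hdr hds ω hy
    have hyr : y ≠ r := by rintro rfl; exact (hT e).1 hey
    have hys : y ≠ s := by rintro rfl; exact (hT e).2 hey
    exact hD y hyr hys hyd (K2_endsD_subset_K2 ω hy) (mem_M2_of_closed hM he hey)
  · rfl

include hdr hds hT hD hK in
/-- An edge from `d` into the `W`-world of `G − d` is `W`. -/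
lemma closed_of_edge_d_M2_endsD {e : E} {y : V} (hey : ends e = s(d, y))
    (hy : y ∈ M2 (endsD ends d) r s ω) : ω e = false := by
  cases he : ω e
  · rfl
  · exfalso
    have hyd : y ≠ d := by rintro rfl; exact not_mem_M2_endsD hdr hds ω hy
    have hyr : y ≠ r := by rintro rfl; exact (hT e).1 hey
    have hys : y ≠ s := by rintro rfl; exact (hT e).2 hey
    exact hD y hyr hys hyd (mem_K2_of_open hK he hey) (M2_endsD_subset_M2 ω hy)

include hdr hds hsep hD hC hCr hCs hcl in
/-- **The `Y`-world of `G − d` at `Ψ₂ ω`** is the `W`-world of `ω` together with `C`. -/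
lemma K2_endsD_psi2 :
    K2 (endsD ends d) r s (fun e => if e ∈ touches ends C then ω e else !ω e) =
      M2 (endsD ends d) r s ω ∪ C := by
  rw [psi2_eq_compl_flipTouch, K2_compl]
  have heq : M2 (endsD ends d) r s (flipTouch ends C ω) =
      M2 (endsD ends d) r s (flipTouch (endsD ends d) C ω) := by
    apply M2_endsD_eq_of_eqOn
    intro e he
    by_cases h : e ∈ touches ends C
    · rw [flipTouch_of_mem ends h, flipTouch_of_mem (endsD ends d) ((mem_touches_endsD_iff he).2 h)]
    · rw [flipTouch_of_notMem ends h,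
        flipTouch_of_notMem (endsD ends d) (fun h' => h ((mem_touches_endsD_iff he).1 h'))]
  rw [heq, M2_flipTouch_of_closed (sep2_endsD_of_sep2 hsep) (fun x hx => Or.inl (hC hx)) hCr hCs
    hcl]
  ext x
  simp only [Set.mem_union, Set.mem_sdiff, Set.mem_inter_iff]
  constructor
  · rintro (⟨h, _⟩ | ⟨h, _⟩)
    · exact Or.inl h
    · exact Or.inr h
  · rintro (h | h)
    · exact Or.inl ⟨h, fun hx => notMem_M2_endsD_of_mem_C hdr hds hD hC hCr hCs hx h⟩
    · exact Or.inr ⟨h, hC h⟩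

include hdr hds hsep hD hC hCr hCs hcl in
/-- **The `W`-world of `G − d` at `Ψ₂ ω`** is the `Y`-world of `ω` without `C`. -/
lemma M2_endsD_psi2 :
    M2 (endsD ends d) r s (fun e => if e ∈ touches ends C then ω e else !ω e) =
      K2 (endsD ends d) r s ω \ C := by
  rw [psi2_eq_compl_flipTouch, M2_compl]
  have heq : K2 (endsD ends d) r s (flipTouch ends C ω) =
      K2 (endsD ends d) r s (flipTouch (endsD ends d) C ω) := by
    apply K2_endsD_eq_of_eqOn
    intro e he
    by_cases h : e ∈ touches ends C
    · rw [flipTouch_of_mem ends h, flipTouch_of_mem (endsD ends d) ((mem_touches_endsD_iff he).2 h)]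
    · rw [flipTouch_of_notMem ends h,
        flipTouch_of_notMem (endsD ends d) (fun h' => h ((mem_touches_endsD_iff he).1 h'))]
  rw [heq, K2_flipTouch_of_closed (sep2_endsD_of_sep2 hsep) (fun x hx => Or.inl (hC hx)) hCr hCs
    hcl]
  ext x
  simp only [Set.mem_union, Set.mem_sdiff, Set.mem_inter_iff]
  constructor
  · rintro (h | ⟨hx, hxM⟩)
    · exact h
    · exact (notMem_M2_endsD_of_mem_C hdr hds hD hC hCr hCs hx hxM).elim
  · exact fun h => Or.inl h

include hdr hds hT hD hK hM hC hCr hCs hcl hCd in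
/-- A closed edge of `Ψ₂ ω` from a `Y`-side vertex of `ω` outside `C` ends in a `Y`-side
vertex outside `C`. -/
lemma mem_S1_of_compl_psi2_adj {x y : V} {e : E} (hends : ends e = s(x, y))
    (hx : x ∈ K2 (endsD ends d) r s ω ∧ x ∉ C)
    (he : (if e ∈ touches ends C then ω e else !ω e) = false) :
    y ∈ K2 (endsD ends d) r s ω ∧ y ∉ C := by
  obtain ⟨hxK, hxC⟩ := hx
  have hxd : x ≠ d := by rintro rfl; exact not_mem_K2_endsD hdr hds ω hxK
  by_cases hyC : y ∈ C
  · exfalso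
    have hyK : y ∈ K2 (endsD ends d) r s ω := hC hyC
    have hyd : y ≠ d := by rintro rfl; exact not_mem_K2_endsD hdr hds ω hyK
    have hde : d ∉ ends e := notMem_of_ends_ne hends hxd hyd
    rw [psi2_of_mem (mem_touches_of_ends hends (Or.inr hyC))] at he
    by_cases hxrs : x = r ∨ x = s
    · -- a closed edge from `r` into `C`: `y` would be in the `W`-world of `G − d`
      have hxM : x ∈ M2 (endsD ends d) r s ω := by
        rcases hxrs with rfl | rfl
        · exact r_mem_M2 x s ω
        · exact s_mem_M2 r x ω
      exact notMem_M2_endsD_of_mem_C hdr hds hD hC hCr hCs hyC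
        (mem_M2_of_closed hxM he (by rw [endsD_of_notMem hde, hends]))
    · -- `x` is sided and adjacent to `C`: it lies in `C`
      have hxS : x ∈ sided (endsD ends d) r s ω :=
        ⟨Or.inl hxK, fun h => hxrs (Or.inl h), fun h => hxrs (Or.inr h)⟩
      exact hxC (hcl e y x (by rw [endsD_of_notMem hde, hends, Sym2.eq_swap]) hyC hxS)
  · rw [psi2_of_notMem (not_mem_touches_of_ends hends hxC hyC)] at he
    have he' : ω e = true := by
      cases h : ω e
      · rw [h] at he; exact absurd he (by decide)
      · rfl
    by_cases hyd : y = d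
    · exfalso
      subst hyd
      exact hxC (hCd e x (by rw [hends, Sym2.eq_swap]) hxK)
    · have hde : d ∉ ends e := notMem_of_ends_ne hends hxd hyd
      exact ⟨mem_K2_of_open hxK he' (by rw [endsD_of_notMem hde, hends]), hyC⟩

include hdr hds hT hD hK hM hC hCr hCs hcl hCd in
/-- **The `W`-world of `{r, s}` at `Ψ₂ ω` lies in `K₂(G − d; ω) ∖ C`.** -/
lemma M2_psi2_subset :
    M2 ends r s (fun e => if e ∈ touches ends C then ω e else !ω e) ⊆
      {x | x ∈ K2 (endsD ends d) r s ω ∧ x ∉ C} := by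
  intro x hx
  have key : ∀ t, (t = r ∨ t = s) →
      Conn ends (OneColourSwitch.compl (fun e => if e ∈ touches ends C then ω e else !ω e)) t x →
      x ∈ {z | z ∈ K2 (endsD ends d) r s ω ∧ z ∉ C} := by
    intro t ht hc
    have htS : t ∈ {z | z ∈ K2 (endsD ends d) r s ω ∧ z ∉ C} := by
      rcases ht with rfl | rfl
      · exact ⟨r_mem_K2 t s ω, hCr⟩
      · exact ⟨s_mem_K2 r t ω, hCs⟩
    refine mem_of_conn_of_closed ?_ htS hc
    intro a ha b hab
    obtain ⟨_, e, he, hends⟩ := openGraph_adj.1 hab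
    have he' : (if e ∈ touches ends C then ω e else !ω e) = false := by
      simp only [OneColourSwitch.compl, Bool.not_eq_true'] at he
      exact he
    exact mem_S1_of_compl_psi2_adj hdr hds hT hD hK hM hC hCr hCs hcl hCd hends ha he'
  rcases mem_M2_iff.1 hx with hc | hc
  · exact key r (Or.inl rfl) hc
  · exact key s (Or.inr rfl) hc

include hdr hds hT hD hK hM hC hCr hCs hcl hCd in
/-- An open edge of `Ψ₂ ω` from the set `S₂ = M₂(G − d) ∪ C ∪ {d} ∪ C_W(d; ω)` ends in `S₂`. -/
lemma mem_S2_of_psi2_adj {x y : V} {e : E} (hends : ends e = s(x, y))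
    (hx : x ∈ M2 (endsD ends d) r s ω ∨ x ∈ C ∨ x = d ∨
      (x ∉ K2 (endsD ends d) r s ω ∧ x ∉ M2 (endsD ends d) r s ω ∧
        Conn ends (OneColourSwitch.compl ω) d x))
    (he : (if e ∈ touches ends C then ω e else !ω e) = true) :
    y ∈ M2 (endsD ends d) r s ω ∨ y ∈ C ∨ y = d ∨
      (y ∉ K2 (endsD ends d) r s ω ∧ y ∉ M2 (endsD ends d) r s ω ∧
        Conn ends (OneColourSwitch.compl ω) d y) := by
  by_cases hyM : y ∈ M2 (endsD ends d) r s ω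
  · exact Or.inl hyM
  by_cases hyC : y ∈ C
  · exact Or.inr (Or.inl hyC)
  by_cases hyd : y = d
  · exact Or.inr (Or.inr (Or.inl hyd))
  refine Or.inr (Or.inr (Or.inr ?_))
  have hyrs : y ≠ r ∧ y ≠ s := by
    constructor
    · rintro rfl; exact hyM (r_mem_M2 y s ω)
    · rintro rfl; exact hyM (s_mem_M2 r y ω)
  rcases hx with hxM | hxC | hxd | ⟨hxK, hxM, hxc⟩
  · -- `x` on the `W`-side: the edge is flipped and `W` at `ω`, so `y ∈ M₂(G − d)`
    exfalso
    have hxC : x ∉ C := fun h => notMem_M2_endsD_of_mem_C hdr hds hD hC hCr hCs h hxM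
    rw [psi2_of_notMem (not_mem_touches_of_ends hends hxC hyC)] at he
    have he' : ω e = false := by
      cases h : ω e
      · rfl
      · rw [h] at he; exact absurd he (by decide)
    have hxd : x ≠ d := by rintro rfl; exact not_mem_M2_endsD hdr hds ω hxM
    have hde : d ∉ ends e := notMem_of_ends_ne hends hxd hyd
    exact hyM (mem_M2_of_closed hxM he' (by rw [endsD_of_notMem hde, hends]))
  · -- `x ∈ C`: the edge is unchanged and `Y`; `y` is sided and adjacent to `C`
    exfalso
    rw [psi2_of_mem (mem_touches_of_ends hends (Or.inl hxC))] at he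
    have hxK : x ∈ K2 (endsD ends d) r s ω := hC hxC
    have hxd : x ≠ d := by rintro rfl; exact not_mem_K2_endsD hdr hds ω hxK
    have hde : d ∉ ends e := notMem_of_ends_ne hends hxd hyd
    have hyK : y ∈ K2 (endsD ends d) r s ω :=
      mem_K2_of_open hxK he (by rw [endsD_of_notMem hde, hends])
    have hyS : y ∈ sided (endsD ends d) r s ω := ⟨Or.inl hyK, hyrs.1, hyrs.2⟩
    exact hyC (hcl e x y (by rw [endsD_of_notMem hde, hends]) hxC hyS)
  · -- `x = d`: `y` is a pocket vertex `W`-joined to `d` at `ω`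
    subst x
    have hyK : y ∉ K2 (endsD ends d) r s ω := fun h => hyC (hCd e y hends h)
    refine ⟨hyK, hyM, ?_⟩
    have hdC : d ∉ C := fun h => not_mem_K2_endsD hdr hds ω (hC h)
    rw [psi2_of_notMem (not_mem_touches_of_ends hends hdC hyC)] at he
    have he' : ω e = false := by
      cases h : ω e
      · rfl
      · rw [h] at he; exact absurd he (by decide)
    exact conn_of_openAdj ⟨e, by simp [OneColourSwitch.compl, he'], hends⟩
  · -- `x` a pocket vertex `W`-joined to `d`: the edge is flipped, `W` at `ω`
    have hxC : x ∉ C := fun h => hxK (hC h)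
    rw [psi2_of_notMem (not_mem_touches_of_ends hends hxC hyC)] at he
    have he' : ω e = false := by
      cases h : ω e
      · rfl
      · rw [h] at he; exact absurd he (by decide)
    have hyc : Conn ends (OneColourSwitch.compl ω) d y :=
      conn_trans hxc (conn_of_openAdj ⟨e, by simp [OneColourSwitch.compl, he'], hends⟩)
    refine ⟨?_, hyM, hyc⟩
    -- `y` is not `Y`-side: it is `W`-joined to `d ∈ M₂` and would be doubly reached
    intro hyK
    have hyM' : y ∈ M2 ends r s ω := by
      rcases mem_M2_iff.1 hM with hc | hc
      · exact mem_M2_iff.2 (Or.inl (conn_trans hc hyc))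
      · exact mem_M2_iff.2 (Or.inr (conn_trans hc hyc))
    exact hD y hyrs.1 hyrs.2 hyd (K2_endsD_subset_K2 ω hyK) hyM'

include hdr hds hT hD hK hM hC hCr hCs hcl hCd in
/-- **The `Y`-world of `{r, s}` at `Ψ₂ ω` lies in `M₂(G − d; ω) ∪ C ∪ {d} ∪ C_W(d; ω)`.** -/
lemma K2_psi2_subset :
    K2 ends r s (fun e => if e ∈ touches ends C then ω e else !ω e) ⊆
      {x | x ∈ M2 (endsD ends d) r s ω ∨ x ∈ C ∨ x = d ∨
        (x ∉ K2 (endsD ends d) r s ω ∧ x ∉ M2 (endsD ends d) r s ω ∧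
          Conn ends (OneColourSwitch.compl ω) d x)} := by
  intro x hx
  have key : ∀ t, (t = r ∨ t = s) →
      Conn ends (fun e => if e ∈ touches ends C then ω e else !ω e) t x →
      x ∈ {z | z ∈ M2 (endsD ends d) r s ω ∨ z ∈ C ∨ z = d ∨
        (z ∉ K2 (endsD ends d) r s ω ∧ z ∉ M2 (endsD ends d) r s ω ∧
          Conn ends (OneColourSwitch.compl ω) d z)} := by
    intro t ht hc
    have htS : t ∈ {z | z ∈ M2 (endsD ends d) r s ω ∨ z ∈ C ∨ z = d ∨
        (z ∉ K2 (endsD ends d) r s ω ∧ z ∉ M2 (endsD ends d) r s ω ∧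
          Conn ends (OneColourSwitch.compl ω) d z)} := by
      rcases ht with rfl | rfl
      · exact Or.inl (r_mem_M2 t s ω)
      · exact Or.inl (s_mem_M2 r t ω)
    refine mem_of_conn_of_closed ?_ htS hc
    intro a ha b hab
    obtain ⟨_, e, he, hends⟩ := openGraph_adj.1 hab
    exact mem_S2_of_psi2_adj hdr hds hT hD hK hM hC hCr hCs hcl hCd hends ha he
  rcases mem_K2_iff.1 hx with hc | hc
  · exact key r (Or.inl rfl) hc
  · exact key s (Or.inr rfl) hc

include hdr hds hT hsep hD hK hM hC hCr hCs hcl hCd in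
/-- **`Ψ₂ ω` is `Sep`.** -/
lemma sep2_psi2 (hp : p ≠ d) (hq : q ≠ d) :
    sep2 ends p q r s (fun e => if e ∈ touches ends C then ω e else !ω e) := by
  have hsepD := sep2_endsD_of_sep2 (d := d) hsep
  obtain ⟨⟨hpK, hqK⟩, ⟨hpM, hqM⟩⟩ := sep2_iff.1 hsepD
  obtain ⟨_, ⟨hpM', hqM'⟩⟩ := sep2_iff.1 hsep
  have hK2 := K2_psi2_subset hdr hds hT hD hK hM hC hCr hCs hcl hCd
  have hM2 := M2_psi2_subset hdr hds hT hD hK hM hC hCr hCs hcl hCd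
  have hdM : ∀ x, Conn ends (OneColourSwitch.compl ω) d x → x ∈ M2 ends r s ω := by
    intro x hx
    rcases mem_M2_iff.1 hM with hc | hc
    · exact mem_M2_iff.2 (Or.inl (conn_trans hc hx))
    · exact mem_M2_iff.2 (Or.inr (conn_trans hc hx))
  rw [sep2_iff]
  refine ⟨⟨fun h => ?_, fun h => ?_⟩, ⟨fun h => hpK (hM2 h).1, fun h => hqK (hM2 h).1⟩⟩
  · rcases hK2 h with h' | h' | h' | ⟨_, _, h'⟩
    · exact hpM h'
    · exact hpK (hC h')
    · exact hp h'
    · exact hpM' (hdM p h')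
  · rcases hK2 h with h' | h' | h' | ⟨_, _, h'⟩
    · exact hqM h'
    · exact hqK (hC h')
    · exact hq h'
    · exact hqM' (hdM q h')

include hdr hds hT hD hK hM hC hCr hCs hcl hCd in
/-- **`Ψ₂ ω` is `DOne`.** -/
lemma DOne_psi2 : DOne ends r s d (fun e => if e ∈ touches ends C then ω e else !ω e) := by
  intro x hxr hxs hxd hxK hxM
  obtain ⟨hxK', hxC⟩ := M2_psi2_subset hdr hds hT hD hK hM hC hCr hCs hcl hCd hxM
  rcases K2_psi2_subset hdr hds hT hD hK hM hC hCr hCs hcl hCd hxK with h | h | h | ⟨h, _, _⟩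
  · exact hD x hxr hxs hxd (K2_endsD_subset_K2 ω hxK') (M2_endsD_subset_M2 ω h)
  · exact hxC h
  · exact hxd h
  · exact h hxK'

end Worlds

end NoPocket

end Summit.Ventures.PercRepro2
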